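import Summits.QuantumFields.YangMills.Theorems.UnitScaleTiltProp7TorusGreen2ThirdDiffDecay
import Summits.QuantumFields.YangMills.Theorems.UnitScaleTiltProp7TorusGreen2GradientBound
import Summits.QuantumFields.YangMills.Theorems.UnitScaleTiltProp7NearFieldGreenSizeSum
import HarnessLib

/-!
# Route `UnitScaleTilt`, crux K1 «MinimiserStabilityRegPr» (stmt-QuantumFields-19200), route-R E′ path (α′), (E1-b)-cov (N-cov) FLAT-CONV kernel instances, FILE P: THE POLE-INCLUSIVE
# (`z`-UNIFORM) BOUNDS FOR THE SECOND AND THIRD DIFFERENCES OF THE BIHARMONIC TORUS GREEN FUNCTION `G̃₂` IN `d = 3` — `|∇ᵢ⁺∇ⱼ⁻G̃₂(z)| ≤ C` and `|∇ₖ⁻∇ᵢ⁺∇ⱼ⁻G̃₂(z)| ≤ C` for ALL `z`,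
# L-uniform (the companions of ✓p662426∕✓p662832, which weight by `dist`∕`dist²` off the pole) — plus the `d`-PARAMETER WRAPPERS (`_of_eq (hd : d = 3)`) of every `G̃₁`∕`G̃₂` row the
# convolution engine ✓p673901 (`Prop7TorusGreenConvolution.conv_*`, weights `max 1 (tdist z x)`) reads at the DIAGONAL `z = x`

Cell `ym3-torus`, D-0154 (3c) twin-width seat `ym-ust-19200-w8` (gen 7); ★routeR-w3 g6 word (12) 22:28:29Z «w8-19200: FLAT-CONV KERNEL INSTANCES — GO … incl. the DIAGONAL value `z = x` where
`1 ∨ tdist` reads the pole bound».  Same heat-kernel route as ✓p662426∕✓p662832 with the Gaussian weight DROPPED (`((1∨s)+z̃²)⁻³ ≤ (1∨s)⁻³`): Hessian `s·K√(1∨s)(1∨s)⁻³ ≤ K(1∨s)^{−3∕2}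
≤ 2√2K((s+1)√(s+1))⁻¹` (time integral `≤ 2`, ✓ `integral_inv_mul_sqrt_le`), third difference `s·K(1∨s)⁻³ ≤ K(1∨s)⁻² ≤ 4K((s+1)²)⁻¹` (`≤ 4K`, ✓ `integral_inv_add_sq_le`); tails
`(π²∕8)C₀³L⁻¹` ∕ `(π³∕4)C₀³L⁻²` ≤ the same constants.  THEOREMS ONLY (0 `def`, 0 `sorry`), `G̃₂` via the displayed definition hypothesis `hG` of record; `--supports stmt-QuantumFields-19200`,
count-neutral.  YM₃ on T³ is a ladder rung (R3), not the Clay problem; nothing here claims the stub, the crux, d = 4 or the gap.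

WHAT IS PROVED (ns `…Theorems.Prop7TorusGreen2PoleBounds`).
* §1 ★★ `abs_green2_hessian_le` (`d = 3`, ALL `z`): `∃ C ≥ 0, ∀ L G hG i j z, |G(z+eᵢ) − G(z+eᵢ−eⱼ) − G(z) + G(z−eⱼ)| ≤ C`.
* §2 ★★ `abs_green2_thirdDiff_le` (`d = 3`, ALL `z`): `∃ C ≥ 0, ∀ L G hG i j k z, |∇ᵢ⁺∇ⱼ⁻G(z) − ∇ᵢ⁺∇ⱼ⁻G(z − e_k)| ≤ C`.
* §3 `d`-wrappers (`∃ C, ∀ {d} (_ : d = 3) …`, so `hd : P.d = 3` instantiates with no `Fin` cast): `abs_torusGreen_le_of_eq` (✓p669156), `abs_torusGreen_grad_le_of_eq` (px7 ✓p662443),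
  `abs_green2_grad_le_of_eq` (px13 ✓p663183), `abs_green2_hessian_le_of_eq`, `green2_thirdDiff_mul_dist_sq_le_of_eq` (✓p662832), `abs_green2_thirdDiff_le_of_eq`.
HONEST SCOPE.  Helper lattice lemmas; no Yang–Mills statement is touched.  The `Site P 0`∕`EK` kernel rows in the engine's `max 1 (tdist z x)` currency are FILE K1 (`…TorusGreenKernelRows`).
References: Lawler–Limic, *Random Walk: A Modern Introduction* (2010) Thm 4.3.1 [LawlerLimic2010]; Bałaban, CMP 99 (1985) 75–102 [Balaban1985RegularSpaces] ((1.36) p.82).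
-/

set_option autoImplicit false

noncomputable section

open MeasureTheory Set Finset ZMod intervalIntegral
open scoped Real BigOperators ComplexConjugate

namespace Summit.QuantumFields.YangMills.Theorems.Prop7TorusGreen2PoleBounds

open Literature.Probability.LatticeModels
open Prop7TorusGreenGradientBricks Prop7TorusGreenHessianDecay Prop7TorusHeatKernelThirdDiffThree
open Prop7TorusGreen2HeatKernel Prop7TorusGreen2HessianDecay Prop7TorusGreen2ThirdDiffDecay Prop7TorusGreen2GradientBound
open Prop7NearFieldGreenGradientSum Prop7NearFieldGreenSizeSum

variable {L : ℕ}

/-! ## §1 ★★ The Hessian of `G̃₂` is bounded, uniformly in the period (all `z`, `d = 3`) -/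

/-- ★★ **`|∇ᵢ⁺∇ⱼ⁻G̃₂(z)| ≤ C` for ALL `z ∈ (ℤ/Lℤ)³`, uniformly in `L ≥ 1`** (`C = 4√2K + (π²∕8)C₀³`): ✓ `hessian_eq` at `S = L²`; the weighted product-kernel Hessian
`s·K√(1∨s)·(((1∨s)+z̃²)³)⁻¹ ≤ K(1∨s)^{−3∕2} ≤ 2√2K((s+1)√(s+1))⁻¹` (Gaussian weight dropped, `2(1∨s) ≥ s+1`), time integral `≤ 2` (✓ `integral_inv_mul_sqrt_le`, `c = 1`); Fourier tail
`≤ (π²∕8)C₀³L²∕L³ ≤ (π²∕8)C₀³` (✓ `abs_hessian_tail_le`).  The pole value of the (R3a) row, read by the convolution engine's `1 ∨ tdist` weight at `z = x`. [folklore] -/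
theorem abs_green2_hessian_le : ∃ C : ℝ, 0 ≤ C ∧ ∀ (L : ℕ) [NeZero L] (G : TorusSite 3 L → ℝ),
    (∀ z, G z = (∑ k ∈ (univ : Finset (TorusSite 3 L)).erase 0,
      Real.cos (∑ i, latticeMomentum L k i * ((z i).val : ℝ)) / dispersion (latticeMomentum L k) ^ 2) / (L : ℝ) ^ 3) →
    ∀ (i j : Fin 3) (z : TorusSite 3 L),
      |G (z + Pi.single i 1) - G (z + Pi.single i 1 - Pi.single j 1) - G z + G (z - Pi.single j 1)| ≤ C := by
  obtain ⟨K, hK, hP⟩ := abs_hessian_prod_torusHeatKernel_le_three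
  set C₀ : ℝ := ∑' n : ℤ, (1 / 2 : ℝ) ^ n.natAbs with hC₀
  have hC₀0 : 0 ≤ C₀ := tsum_nonneg fun n => by positivity
  refine ⟨4 * Real.sqrt 2 * K + π ^ 2 / 8 * C₀ ^ 3, by positivity, ?_⟩
  intro L _ G hG i j z
  have hL : (0 : ℝ) < L := by exact_mod_cast Nat.pos_of_ne_zero (NeZero.ne L)
  have hL1 : (1 : ℝ) ≤ L := by exact_mod_cast Nat.one_le_iff_ne_zero.mpr (NeZero.ne L)
  have hS : (0 : ℝ) ≤ (L : ℝ) ^ 2 := by positivity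
  rw [hessian_eq G hG z i j ((L : ℝ) ^ 2)]
  -- heat-kernel part
  have hmain : |∫ s in (0 : ℝ)..(L : ℝ) ^ 2, s *
      ((∏ μ, torusHeatKernel s ((z + Pi.single i 1 : TorusSite 3 L) μ)) -
        (∏ μ, torusHeatKernel s ((z + Pi.single i 1 - Pi.single j 1 : TorusSite 3 L) μ)) -
        (∏ μ, torusHeatKernel s (z μ)) +
        ∏ μ, torusHeatKernel s ((z - Pi.single j 1 : TorusSite 3 L) μ))| ≤ 4 * Real.sqrt 2 * K := by
    have hb : ∀ s ∈ Set.Ioc (0 : ℝ) ((L : ℝ) ^ 2),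
        |s * ((∏ μ, torusHeatKernel s ((z + Pi.single i 1 : TorusSite 3 L) μ)) -
          (∏ μ, torusHeatKernel s ((z + Pi.single i 1 - Pi.single j 1 : TorusSite 3 L) μ)) -
          (∏ μ, torusHeatKernel s (z μ)) +
          ∏ μ, torusHeatKernel s ((z - Pi.single j 1 : TorusSite 3 L) μ))| ≤
        2 * Real.sqrt 2 * K * ((s + 1) * Real.sqrt (s + 1))⁻¹ := by
      intro s hs
      rw [abs_mul, abs_of_pos hs.1]
      have h := hP L s hs.1 hs.2 z i j i
      set T : ℝ := max 1 s with hT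
      set c : ℝ := ((z i).valMinAbs : ℝ) ^ 2 with hc
      have hc0 : 0 ≤ c := sq_nonneg _
      have hT1 : 1 ≤ T := le_max_left _ _
      have hTs : s ≤ T := le_max_right _ _
      have hT0 : 0 < T := by positivity
      have hs1 : 0 < s + 1 := by linarith [hs.1]
      -- `s·√T·((T+c)³)⁻¹ ≤ √T·T⁻² ≤ 2√2((s+1)√(s+1))⁻¹`
      have h1 : s * Real.sqrt T * ((T + c) ^ 3)⁻¹ ≤ Real.sqrt T * (T ^ 2)⁻¹ := by
        have h3 : ((T + c) ^ 3)⁻¹ ≤ (T ^ 3)⁻¹ := by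
          apply inv_anti₀ (by positivity)
          exact pow_le_pow_left₀ hT0.le (by linarith) 3
        calc s * Real.sqrt T * ((T + c) ^ 3)⁻¹ ≤ T * Real.sqrt T * (T ^ 3)⁻¹ := by gcongr
          _ = Real.sqrt T * (T ^ 2)⁻¹ := by field_simp
      have hTinv : T⁻¹ ≤ 2 / (s + 1) := by
        rw [inv_eq_one_div, div_le_div_iff₀ hT0 hs1, one_mul]
        rcases le_or_gt s 1 with h1s | h1s
        · rw [hT, max_eq_left h1s]; linarith
        · rw [hT, max_eq_right h1s.le]; linarith
      have hsqrtT : Real.sqrt T * T⁻¹ ≤ Real.sqrt 2 / Real.sqrt (s + 1) := by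
        -- `√T·T⁻¹ = √(T⁻¹) ≤ √(2∕(s+1))`
        have e : Real.sqrt T * T⁻¹ = Real.sqrt (T⁻¹) := by
          rw [Real.sqrt_inv, ← one_div, ← Real.sqrt_sq hT0.le, Real.sqrt_sq hT0.le]
          field_simp
          rw [Real.sq_sqrt hT0.le]
        rw [e, ← Real.sqrt_div (by norm_num : (0 : ℝ) ≤ 2) (s + 1)]
        exact Real.sqrt_le_sqrt hTinv
      have h2 : Real.sqrt T * (T ^ 2)⁻¹ ≤ 2 * Real.sqrt 2 * ((s + 1) * Real.sqrt (s + 1))⁻¹ := by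
        have hsq1 : 0 < Real.sqrt (s + 1) := Real.sqrt_pos.2 hs1
        calc Real.sqrt T * (T ^ 2)⁻¹ = (Real.sqrt T * T⁻¹) * T⁻¹ := by field_simp
          _ ≤ (Real.sqrt 2 / Real.sqrt (s + 1)) * (2 / (s + 1)) :=
              mul_le_mul hsqrtT hTinv (by positivity) (by positivity)
          _ = 2 * Real.sqrt 2 * ((s + 1) * Real.sqrt (s + 1))⁻¹ := by field_simp
      calc s * |(∏ μ, torusHeatKernel s ((z + Pi.single i 1 : TorusSite 3 L) μ)) -
            (∏ μ, torusHeatKernel s ((z + Pi.single i 1 - Pi.single j 1 : TorusSite 3 L) μ)) -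
            (∏ μ, torusHeatKernel s (z μ)) +
            ∏ μ, torusHeatKernel s ((z - Pi.single j 1 : TorusSite 3 L) μ)|
          ≤ s * (K * Real.sqrt T * ((T + c) ^ 3)⁻¹) := mul_le_mul_of_nonneg_left h hs.1.le
        _ = K * (s * Real.sqrt T * ((T + c) ^ 3)⁻¹) := by ring
        _ ≤ K * (2 * Real.sqrt 2 * ((s + 1) * Real.sqrt (s + 1))⁻¹) := mul_le_mul_of_nonneg_left (h1.trans h2) hK.le
        _ = 2 * Real.sqrt 2 * K * ((s + 1) * Real.sqrt (s + 1))⁻¹ := by ring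
    have hcont : IntervalIntegrable (fun s : ℝ => 2 * Real.sqrt 2 * K * ((s + 1) * Real.sqrt (s + 1))⁻¹) volume 0 ((L : ℝ) ^ 2) := by
      refine ContinuousOn.intervalIntegrable ?_
      rw [Set.uIcc_of_le hS]
      refine continuousOn_const.mul (ContinuousOn.inv₀ ((continuousOn_id.add continuousOn_const).mul
        ((continuousOn_id.add continuousOn_const).sqrt)) fun s hs => ?_)
      have hsc : 0 < s + 1 := by linarith [hs.1]
      exact mul_ne_zero hsc.ne' (Real.sqrt_ne_zero'.2 hsc)
    calc _ ≤ ∫ s in (0 : ℝ)..(L : ℝ) ^ 2, 2 * Real.sqrt 2 * K * ((s + 1) * Real.sqrt (s + 1))⁻¹ := by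
          have h := intervalIntegral.norm_integral_le_of_norm_le hS
            (Filter.Eventually.of_forall fun s hs => (Real.norm_eq_abs _).le.trans (hb s hs)) hcont
          rwa [Real.norm_eq_abs] at h
      _ = 2 * Real.sqrt 2 * K * ∫ s in (0 : ℝ)..(L : ℝ) ^ 2, ((s + 1) * Real.sqrt (s + 1))⁻¹ := intervalIntegral.integral_const_mul _ _
      _ ≤ 2 * Real.sqrt 2 * K * (2 / Real.sqrt 1) := by
          gcongr
          exact integral_inv_mul_sqrt_le one_pos hS
      _ = 4 * Real.sqrt 2 * K := by rw [Real.sqrt_one]; ring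
  -- Fourier tail
  have htail := abs_hessian_tail_le z i j (L := L) (d := 3)
  rw [← hC₀] at htail
  have hL3 : π ^ 2 / 8 * C₀ ^ 3 * (L : ℝ) ^ 2 / (L : ℝ) ^ 3 ≤ π ^ 2 / 8 * C₀ ^ 3 := by
    rw [show π ^ 2 / 8 * C₀ ^ 3 * (L : ℝ) ^ 2 / (L : ℝ) ^ 3 = π ^ 2 / 8 * C₀ ^ 3 * (L : ℝ)⁻¹ by field_simp]
    exact mul_le_of_le_one_right (by positivity) (inv_le_one_of_one_le₀ hL1)
  exact (abs_add_le _ _).trans (add_le_add hmain (htail.trans hL3))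

/-! ## §2 ★★ The third differences of `G̃₂` are bounded, uniformly in the period (all `z`, `d = 3`) -/

/-- ★★ **`|∇ᵢ⁺∇ⱼ⁻G̃₂(z) − ∇ᵢ⁺∇ⱼ⁻G̃₂(z − e_k)| ≤ C` for ALL `z`, uniformly in `L ≥ 1`** (`C = 4K + (π³∕4)C₀³`): ✓ `thirdDiff_eq` at `S = L²`; `s·K(((1∨s)+z̃²)³)⁻¹ ≤ K(1∨s)⁻² ≤
4K((s+1)²)⁻¹` (time integral `≤ 1`, ✓ `integral_inv_add_sq_le`), tail `≤ (π³∕4)C₀³L∕L³ ≤ (π³∕4)C₀³` (✓ `abs_thirdDiff_tail_le`). [folklore] -/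
theorem abs_green2_thirdDiff_le : ∃ C : ℝ, 0 ≤ C ∧ ∀ (L : ℕ) [NeZero L] (G : TorusSite 3 L → ℝ),
    (∀ z, G z = (∑ k ∈ (univ : Finset (TorusSite 3 L)).erase 0,
      Real.cos (∑ i, latticeMomentum L k i * ((z i).val : ℝ)) / dispersion (latticeMomentum L k) ^ 2) / (L : ℝ) ^ 3) →
    ∀ (i j k : Fin 3) (z : TorusSite 3 L),
      |(G (z + Pi.single i 1) - G (z + Pi.single i 1 - Pi.single j 1) - G z + G (z - Pi.single j 1)) -
          (G (z - Pi.single k 1 + Pi.single i 1) - G (z - Pi.single k 1 + Pi.single i 1 - Pi.single j 1) -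
            G (z - Pi.single k 1) + G (z - Pi.single k 1 - Pi.single j 1))| ≤ C := by
  obtain ⟨K, hK, hP⟩ := abs_thirdDiff_hessian_prod_torusHeatKernel_le_three
  set C₀ : ℝ := ∑' n : ℤ, (1 / 2 : ℝ) ^ n.natAbs with hC₀
  have hC₀0 : 0 ≤ C₀ := tsum_nonneg fun n => by positivity
  refine ⟨4 * K + π ^ 3 / 4 * C₀ ^ 3, by positivity, ?_⟩
  intro L _ G hG i j k z
  have hL : (0 : ℝ) < L := by exact_mod_cast Nat.pos_of_ne_zero (NeZero.ne L)
  have hL1 : (1 : ℝ) ≤ L := by exact_mod_cast Nat.one_le_iff_ne_zero.mpr (NeZero.ne L)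
  have hS : (0 : ℝ) ≤ (L : ℝ) ^ 2 := by positivity
  rw [thirdDiff_eq G hG z i j k ((L : ℝ) ^ 2)]
  have hmain : |∫ s in (0 : ℝ)..(L : ℝ) ^ 2, s *
      (((∏ μ, torusHeatKernel s ((z + Pi.single i 1 : TorusSite 3 L) μ)) -
          (∏ μ, torusHeatKernel s ((z + Pi.single i 1 - Pi.single j 1 : TorusSite 3 L) μ)) -
          (∏ μ, torusHeatKernel s (z μ)) + ∏ μ, torusHeatKernel s ((z - Pi.single j 1 : TorusSite 3 L) μ)) -
        ((∏ μ, torusHeatKernel s ((z - Pi.single k 1 + Pi.single i 1 : TorusSite 3 L) μ)) -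
          (∏ μ, torusHeatKernel s ((z - Pi.single k 1 + Pi.single i 1 - Pi.single j 1 : TorusSite 3 L) μ)) -
          (∏ μ, torusHeatKernel s ((z - Pi.single k 1 : TorusSite 3 L) μ)) +
          ∏ μ, torusHeatKernel s ((z - Pi.single k 1 - Pi.single j 1 : TorusSite 3 L) μ)))| ≤ 4 * K := by
    have hb : ∀ s ∈ Set.Ioc (0 : ℝ) ((L : ℝ) ^ 2), |s *
        (((∏ μ, torusHeatKernel s ((z + Pi.single i 1 : TorusSite 3 L) μ)) -
            (∏ μ, torusHeatKernel s ((z + Pi.single i 1 - Pi.single j 1 : TorusSite 3 L) μ)) -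
            (∏ μ, torusHeatKernel s (z μ)) + ∏ μ, torusHeatKernel s ((z - Pi.single j 1 : TorusSite 3 L) μ)) -
          ((∏ μ, torusHeatKernel s ((z - Pi.single k 1 + Pi.single i 1 : TorusSite 3 L) μ)) -
            (∏ μ, torusHeatKernel s ((z - Pi.single k 1 + Pi.single i 1 - Pi.single j 1 : TorusSite 3 L) μ)) -
            (∏ μ, torusHeatKernel s ((z - Pi.single k 1 : TorusSite 3 L) μ)) +
            ∏ μ, torusHeatKernel s ((z - Pi.single k 1 - Pi.single j 1 : TorusSite 3 L) μ)))| ≤ 4 * K * ((s + 1) ^ 2)⁻¹ := by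
      intro s hs
      rw [abs_mul, abs_of_pos hs.1]
      have h := hP L s hs.1 hs.2 z i j k i
      set T : ℝ := max 1 s with hT
      set c : ℝ := ((z i).valMinAbs : ℝ) ^ 2 with hc
      have hc0 : 0 ≤ c := sq_nonneg _
      have hT1 : 1 ≤ T := le_max_left _ _
      have hTs : s ≤ T := le_max_right _ _
      have hT0 : 0 < T := by positivity
      -- `s·((T+c)³)⁻¹ ≤ T·(T³)⁻¹ = (T²)⁻¹ ≤ 4·((s+1)²)⁻¹`
      have h1 : s * ((T + c) ^ 3)⁻¹ ≤ T * (T ^ 3)⁻¹ := by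
        gcongr
        linarith
      have h2 : T * (T ^ 3)⁻¹ = (T ^ 2)⁻¹ := by field_simp
      have h3 : (T ^ 2)⁻¹ ≤ 4 * ((s + 1) ^ 2)⁻¹ := by
        rw [show (4 : ℝ) * ((s + 1) ^ 2)⁻¹ = (((s + 1) / 2) ^ 2)⁻¹ by field_simp; ring]
        apply inv_anti₀ (by have := hs.1; positivity)
        apply pow_le_pow_left₀ (by have := hs.1; positivity)
        rw [hT, le_max_iff]
        by_cases h1s : s ≤ 1
        · left; linarith
        · right; linarith
      calc s * |_| ≤ s * (K * ((T + c) ^ 3)⁻¹) := mul_le_mul_of_nonneg_left h hs.1.le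
        _ = K * (s * ((T + c) ^ 3)⁻¹) := by ring
        _ ≤ K * (4 * ((s + 1) ^ 2)⁻¹) := mul_le_mul_of_nonneg_left (h1.trans (h2.le.trans h3)) hK.le
        _ = 4 * K * ((s + 1) ^ 2)⁻¹ := by ring
    have hcont : IntervalIntegrable (fun s : ℝ => 4 * K * ((s + 1) ^ 2)⁻¹) volume 0 ((L : ℝ) ^ 2) := by
      refine ContinuousOn.intervalIntegrable ?_
      rw [Set.uIcc_of_le hS]
      refine continuousOn_const.mul (ContinuousOn.inv₀ ((continuousOn_id.add continuousOn_const).pow 2) fun s hs => ?_)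
      have : 0 < s + 1 := by have := hs.1; positivity
      positivity
    calc _ ≤ ∫ s in (0 : ℝ)..(L : ℝ) ^ 2, 4 * K * ((s + 1) ^ 2)⁻¹ := by
          have h := intervalIntegral.norm_integral_le_of_norm_le hS
            (Filter.Eventually.of_forall fun s hs => (Real.norm_eq_abs _).le.trans (hb s hs)) hcont
          rwa [Real.norm_eq_abs] at h
      _ = 4 * K * ∫ s in (0 : ℝ)..(L : ℝ) ^ 2, ((s + 1) ^ 2)⁻¹ := intervalIntegral.integral_const_mul _ _
      _ ≤ 4 * K * (1 : ℝ)⁻¹ := by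
          gcongr
          exact integral_inv_add_sq_le one_pos hS
      _ = 4 * K := by simp
  have htail := abs_thirdDiff_tail_le z i j k (L := L) (d := 3)
  rw [← hC₀] at htail
  have hL3 : π ^ 3 / 4 * C₀ ^ 3 * (L : ℝ) / (L : ℝ) ^ 3 ≤ π ^ 3 / 4 * C₀ ^ 3 := by
    rw [show π ^ 3 / 4 * C₀ ^ 3 * (L : ℝ) / (L : ℝ) ^ 3 = π ^ 3 / 4 * C₀ ^ 3 * ((L : ℝ) ^ 2)⁻¹ by field_simp]
    apply mul_le_of_le_one_right (by positivity)
    apply inv_le_one_of_one_le₀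
    nlinarith
  exact (abs_add_le _ _).trans (add_le_add hmain (htail.trans hL3))

/-! ## §3 The `d`-parameter wrappers (`hd : P.d = 3` instantiates with no `Fin` cast) -/

/-- `d`-wrapper of ✓ `Prop7NearFieldGreenSizeSum.abs_torusGreen_le` (`|G̃₁(z)| ≤ C₀`, all `z`). [folklore] -/
theorem abs_torusGreen_le_of_eq : ∃ C : ℝ, 0 ≤ C ∧ ∀ {d : ℕ} (_ : d = 3) (L : ℕ) [NeZero L] (z : TorusSite d L), |torusGreen z| ≤ C := by
  obtain ⟨C, hC, h⟩ := abs_torusGreen_le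
  exact ⟨C, hC, fun {d} hd => by subst hd; exact h⟩

/-- `d`-wrapper of px7's ✓ `Prop7NearFieldGreenGradientSum.abs_torusGreen_grad_le` (`|G̃₁(z+eᵢ) − G̃₁(z)| ≤ C₁`, all `z`). [folklore] -/
theorem abs_torusGreen_grad_le_of_eq : ∃ C : ℝ, 0 ≤ C ∧ ∀ {d : ℕ} (_ : d = 3) (L : ℕ) [NeZero L] (i : Fin d) (z : TorusSite d L),
    |torusGreen (z + Pi.single i 1) - torusGreen z| ≤ C := by
  obtain ⟨C, hC, h⟩ := abs_torusGreen_grad_le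
  exact ⟨C, hC, fun {d} hd => by subst hd; exact h⟩

/-- `d`-wrapper of px13's ✓ `Prop7TorusGreen2GradientBound.abs_torusGreen2_grad_le` (`|G̃₂(z+eᵢ) − G̃₂(z)| ≤ C`, all `z`). [folklore] -/
theorem abs_green2_grad_le_of_eq : ∃ C : ℝ, 0 ≤ C ∧ ∀ {d : ℕ} (_ : d = 3) (L : ℕ) [NeZero L] (G : TorusSite d L → ℝ),
    (∀ z, G z = (∑ q ∈ (univ : Finset (TorusSite d L)).erase 0,
      Real.cos (∑ i, latticeMomentum L q i * ((z i).val : ℝ)) / dispersion (latticeMomentum L q) ^ 2) / (L : ℝ) ^ d) →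
    ∀ (i : Fin d) (z : TorusSite d L), |G (z + Pi.single i 1) - G z| ≤ C := by
  obtain ⟨C, h⟩ := abs_torusGreen2_grad_le
  refine ⟨max C 0, le_max_right _ _, fun {d} hd => ?_⟩
  subst hd
  intro L _ G hG i z
  exact (h L G hG i z).trans (le_max_left _ _)

/-- `d`-wrapper of §1. [folklore] -/
theorem abs_green2_hessian_le_of_eq : ∃ C : ℝ, 0 ≤ C ∧ ∀ {d : ℕ} (_ : d = 3) (L : ℕ) [NeZero L] (G : TorusSite d L → ℝ),
    (∀ z, G z = (∑ q ∈ (univ : Finset (TorusSite d L)).erase 0,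
      Real.cos (∑ i, latticeMomentum L q i * ((z i).val : ℝ)) / dispersion (latticeMomentum L q) ^ 2) / (L : ℝ) ^ d) →
    ∀ (i j : Fin d) (z : TorusSite d L),
      |G (z + Pi.single i 1) - G (z + Pi.single i 1 - Pi.single j 1) - G z + G (z - Pi.single j 1)| ≤ C := by
  obtain ⟨C, hC, h⟩ := abs_green2_hessian_le
  exact ⟨C, hC, fun {d} hd => by subst hd; exact h⟩

/-- `d`-wrapper of ✓ `Prop7TorusGreen2ThirdDiffDecay.thirdDiff_mul_dist_sq_le` ((R3b): `|∇³G̃₂(z)|·Σz̃² ≤ C`, `z ≠ 0`). [folklore] -/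
theorem green2_thirdDiff_mul_dist_sq_le_of_eq : ∃ C : ℝ, ∀ {d : ℕ} (_ : d = 3) (L : ℕ) [NeZero L] (G : TorusSite d L → ℝ),
    (∀ z, G z = (∑ q ∈ (univ : Finset (TorusSite d L)).erase 0,
      Real.cos (∑ i, latticeMomentum L q i * ((z i).val : ℝ)) / dispersion (latticeMomentum L q) ^ 2) / (L : ℝ) ^ d) →
    ∀ (i j k : Fin d) (z : TorusSite d L), z ≠ 0 →
      |(G (z + Pi.single i 1) - G (z + Pi.single i 1 - Pi.single j 1) - G z + G (z - Pi.single j 1)) -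
          (G (z - Pi.single k 1 + Pi.single i 1) - G (z - Pi.single k 1 + Pi.single i 1 - Pi.single j 1) -
            G (z - Pi.single k 1) + G (z - Pi.single k 1 - Pi.single j 1))| *
        (∑ μ, (((z μ).valMinAbs : ℤ) : ℝ) ^ 2) ≤ C := by
  obtain ⟨C, h⟩ := thirdDiff_mul_dist_sq_le
  exact ⟨C, fun {d} hd => by subst hd; exact h⟩

/-- `d`-wrapper of §2. [folklore] -/
theorem abs_green2_thirdDiff_le_of_eq : ∃ C : ℝ, 0 ≤ C ∧ ∀ {d : ℕ} (_ : d = 3) (L : ℕ) [NeZero L] (G : TorusSite d L → ℝ),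
    (∀ z, G z = (∑ q ∈ (univ : Finset (TorusSite d L)).erase 0,
      Real.cos (∑ i, latticeMomentum L q i * ((z i).val : ℝ)) / dispersion (latticeMomentum L q) ^ 2) / (L : ℝ) ^ d) →
    ∀ (i j k : Fin d) (z : TorusSite d L),
      |(G (z + Pi.single i 1) - G (z + Pi.single i 1 - Pi.single j 1) - G z + G (z - Pi.single j 1)) -
          (G (z - Pi.single k 1 + Pi.single i 1) - G (z - Pi.single k 1 + Pi.single i 1 - Pi.single j 1) -
            G (z - Pi.single k 1) + G (z - Pi.single k 1 - Pi.single j 1))| ≤ C := by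
  obtain ⟨C, hC, h⟩ := abs_green2_thirdDiff_le
  exact ⟨C, hC, fun {d} hd => by subst hd; exact h⟩

end Summit.QuantumFields.YangMills.Theorems.Prop7TorusGreen2PoleBounds
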